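import Literature.NumberTheory.Automorphic.ShimuraCurveLocalUnitNorms
import Literature.NumberTheory.Automorphic.BrandtXi
import Literature.NumberTheory.Automorphic.BrandtModuleDictionary
import Literature.NumberTheory.Automorphic.DefiniteMaximalOrdersLeftOrderFibres
import Literature.NumberTheory.Automorphic.DefiniteOrderUnitsFinite
import Literature.NumberTheory.Automorphic.BrandtMatrixThetaSeries
import Literature.NumberTheory.Automorphic.BrandtThetaSeriesClassFunction
import Literature.NumberTheory.ModularForms.SiegelThetaMultiplierGaussSum
import Literature.NumberTheory.ModularForms.SiegelThetaMultiplierCyclotomic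
import Literature.NumberTheory.EllipticCurves.ModularFormsGamma0Genus
import Mathlib.NumberTheory.ModularForms.CuspFormSubmodule
import Mathlib.LinearAlgebra.Matrix.ToLin
import Literature.NumberTheory.Automorphic.BrandtSetupAdmissible
import HarnessLib
import Literature.NumberTheory.Automorphic.BrandtThetaSeriesHeckeAction
import Literature.NumberTheory.Automorphic.BrandtHeckeProjector
import Literature.NumberTheory.Automorphic.BrandtEigenvectorDegreeZero
import Literature.NumberTheory.Automorphic.EichlerSubidealCount
import Literature.NumberTheory.EllipticCurves.CongruenceNumber
import Literature.NumberTheory.EllipticCurves.HeckeCongruenceModulus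
import Literature.NumberTheory.EllipticCurves.NewformsMultiplicityOneProofs
import Literature.NumberTheory.EllipticCurves.NewformsHeckeProofs
import Literature.NumberTheory.EllipticCurves.NewformsRealCoefficients
import Summits.ABC.ABC.Theses.DefiniteXi
import Literature.NumberTheory.Automorphic.BrandtEigenvectorNonEisenstein
import Literature.NumberTheory.Automorphic.BrandtXiSetupIndependence
import Literature.NumberTheory.EllipticCurves.PastenSpectralDegreeProofs
import Literature.NumberTheory.EllipticCurves.PastenCongruenceModulusProofs
import Literature.NumberTheory.EllipticCurves.ModularDegreeMinimal
import Literature.NumberTheory.EllipticCurves.ModularCurveManinSemistableBridgeProofs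
import Literature.NumberTheory.EllipticCurves.SzpiroFreyConductorProofs
import Literature.NumberTheory.Automorphic.ShimuraCurveRibetTakahashiCokernelProofs
import Literature.NumberTheory.EllipticCurves.PastenValuationProductThm75MultiplicityProofs
-- post-08-17 Literature audited this gen (tree match; none shortens A★ — see STUB-IDEAS k1 gen 21 §1):
import Literature.NumberTheory.Automorphic.BrandtXiDvdCongruenceIdeal
import Literature.NumberTheory.Automorphic.PollackWestonCongruence
import Literature.NumberTheory.EllipticCurves.RibetTakahashiDefinite
import Literature.NumberTheory.EllipticCurves.RibetTakahashiDefinitePrime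
import Literature.NumberTheory.EllipticCurves.RibetTakahashiDefinitePrimeEisenstein

/-!
# STUB-IDEAS k1 GEN 21 — farm sanity of the A★ interface (`stub_xiDegreeComparison`, crux `SteinbergCore`, stmt-ABC-15024)

Purpose (stub-ideation, Family 1): (i) confirm that the FULL import closure of the critic's monolith
`STUB_PLAN_stub_xiDegreeComparison_XiMono.lean` (33 Literature/Mathlib modules + `Theses.DefiniteXi`; the stale
`Theorems.DefiniteXiXiStrongBoundAllTamExp` import is dropped exactly as `cut_pieces.py` does) BUILDS on today's farm —
i.e. the landing path for helper modules Xi1–Xi10 is open; (ii) re-elaborate the four INTERFACE statements of plan A★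
(verbatim from XiMono §1c / PART III) and the composition shape `XiCongruenceComparison → OneSidedARSFrey →
FreyModularity → StubHeader`; (iii) `#check` the post-08-17 Literature declarations audited in the gen-21 ideas file.
No proofs (planner seat); every `theorem` below is definitional glue (`id`-shaped).
-/

set_option linter.dupNamespace false

noncomputable section

namespace Summit.ABC.ABC.Cruxes.SteinbergCore.StubIdeasK1G21

open scoped MatrixGroups ModularForm
open CongruenceSubgroup
open Literature.NumberTheory.EllipticCurves Literature.NumberTheory.EllipticCurves.ModularForms
open Literature.NumberTheory.Automorphic Literature.NumberTheory.Automorphic.Brandt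

/-- The registered stub header, verbatim (`Lines/p6_tamagawa_split.lean`, `stub_xiDegreeComparison`). -/
def StubHeader : Prop :=
  ∀ ε : ℝ, 0 < ε → ∃ C : ℝ, ∀ a b : ℤ, IsCoprime a b → a * b * (a + b) ≠ 0 → ∀ (N : ℕ) [NeZero N],
      (Literature.NumberTheory.EllipticCurves.freyCurve a b).conductorNorm ℤ = N →
      ∀ Nm : ℕ, Odd Nm → Squarefree Nm → Odd Nm.primeFactors.card → Nm ∣ N →
      Literature.NumberTheory.Automorphic.brandtXi (N / Nm) Nm
          (fun n => (Literature.NumberTheory.EllipticCurves.freyCurve a b).LFunction n) ≠ 0 →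
      ∃ D : Literature.NumberTheory.EllipticCurves.ModularForms.ModularParametrizationData
        (Literature.NumberTheory.EllipticCurves.freyCurve a b) N,
        (∀ D' : Literature.NumberTheory.EllipticCurves.ModularForms.ModularParametrizationData
          (Literature.NumberTheory.EllipticCurves.freyCurve a b) N, D.deg ≤ D'.deg) ∧
        ((Literature.NumberTheory.Automorphic.brandtXi (N / Nm) Nm
              (fun n => (Literature.NumberTheory.EllipticCurves.freyCurve a b).LFunction n) /
            (ordProj[2] (Literature.NumberTheory.Automorphic.brandtXi (N / Nm) Nm
                (fun n => (Literature.NumberTheory.EllipticCurves.freyCurve a b).LFunction n)) *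
              ordProj[3] (Literature.NumberTheory.Automorphic.brandtXi (N / Nm) Nm
                (fun n => (Literature.NumberTheory.EllipticCurves.freyCurve a b).LFunction n))) : ℕ) : ℝ) ≤
          C * (N : ℝ) ^ ε * ((D.deg / (ordProj[2] D.deg * ordProj[3] D.deg) : ℕ) : ℝ) *
            ((∏ q ∈ N.primeFactors, ((Literature.NumberTheory.EllipticCurves.freyCurve a b).minimalDiscriminantNorm
              ℤ).factorization q : ℕ) : ℝ) ^ 3

/-- Child 1♮ (XiMono §1c `XiCongruenceComparison`, verbatim): `cps ξ ≤ C_ε N^ε · cps(r_f)` for every newform `f` of `E_(a,b)`.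
PROVED unconditionally in XiMono (`StubIdeasK1G11.xiCongruenceComparison`); lands as helper module Xi10. -/
def XiCongruenceComparison : Prop :=
  ∀ ε : ℝ, 0 < ε → ∃ C : ℝ, ∀ a b : ℤ, IsCoprime a b → a * b * (a + b) ≠ 0 → ∀ (N : ℕ) [NeZero N],
    (freyCurve a b).conductorNorm ℤ = N →
    ∀ Nm : ℕ, Odd Nm → Squarefree Nm → Odd Nm.primeFactors.card → Nm ∣ N →
    brandtXi (N / Nm) Nm (fun n => (freyCurve a b).LFunction n) ≠ 0 →
    ∀ f : CuspForm (Gamma0 N) 2, IsNewformOf (freyCurve a b) f →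
      ((brandtXi (N / Nm) Nm (fun n => (freyCurve a b).LFunction n) /
          (ordProj[2] (brandtXi (N / Nm) Nm (fun n => (freyCurve a b).LFunction n)) *
            ordProj[3] (brandtXi (N / Nm) Nm (fun n => (freyCurve a b).LFunction n))) : ℕ) : ℝ) ≤
        C * (N : ℝ) ^ ε *
          ((congruenceNumber f / (ordProj[2] (congruenceNumber f) * ordProj[3] (congruenceNumber f)) : ℕ) : ℝ)

/-- H5 ONE-SIDED ARS (XiMono §1c, verbatim). [cite: AgasheRibetStein2012, Thm. 2.1] -/
def OneSidedARS : Prop :=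
  ∀ (W : WeierstrassCurve ℚ) [W.IsElliptic] (N : ℕ) [NeZero N] (D : ModularParametrizationData W N),
    (∀ (W' : WeierstrassCurve ℚ) [W'.IsElliptic] (D' : ModularParametrizationData W' N),
        D'.f = D.f → D.modularDegree ≤ D'.modularDegree) →
      ∀ p : ℕ, p.Prime → 5 ≤ p → ¬ p ^ 2 ∣ N →
        padicValNat p (congruenceNumber D.f) ≤ padicValNat p D.modularDegree

/-- H5♭ ONE-SIDED ARS, Frey form (XiMono §1c, verbatim) — the ONLY non-item input the registered stub consumes. -/
def OneSidedARSFrey : Prop :=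
  ∀ (a b : ℤ), IsCoprime a b → a * b * (a + b) ≠ 0 →
    ∀ (N : ℕ) [NeZero N], (freyCurve a b).conductorNorm ℤ = N →
    ∀ (D : ModularParametrizationData (freyCurve a b) N) (p : ℕ), p.Prime → 5 ≤ p →
      padicValNat p (congruenceNumber D.f) ≤ padicValNat p D.modularDegree

/-- INTERFACE SHAPE of plan A★ (types only): the landed helpers must provide
`h10 : XiCongruenceComparison` (Xi10), `h8 : ARS-fact → OneSidedARS`, `h8' : OneSidedARS → OneSidedARSFrey`,
`hA : XiCongruenceComparison → OneSidedARSFrey → FreyModularity → StubHeader` (Xi10 `stub_of_xiCongruenceComparison_oneSidedFrey`);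
then the stub is `hA h10 (h8' (h8 hARS)) hMod`.  This theorem only certifies that the five types elaborate and compose. -/
theorem stubHeader_of_interface
    (hA : XiCongruenceComparison → OneSidedARSFrey → Summit.ABC.ABC.Theses.DefiniteXi.FreyModularity → StubHeader)
    (h10 : XiCongruenceComparison)
    (h8 : padicValNat_congruenceNumber_eq_of_not_sq_dvd → OneSidedARS)
    (h8' : OneSidedARS → OneSidedARSFrey)
    (hARS : padicValNat_congruenceNumber_eq_of_not_sq_dvd)
    (hMod : Summit.ABC.ABC.Theses.DefiniteXi.FreyModularity) : StubHeader :=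
  hA h10 (h8' (h8 hARS)) hMod

-- post-08-17 Literature audited in the ideas file (tree match, Family 1):
#check @XiSetup.xi_dvd_twelve_mul_of_mem_congruenceIdeal          -- ξ ∣ 12·η(𝕋⁰(S)) : Brandt-side congruence ideal
#check @PollackWeston2011.thm_6_8_ellipticCurve                      -- named FACT, hypothesis p ∤ N (off-level only) + CR
#check @padicValNat_congruenceNumber_eq_xi_of_not_dvd                -- prime type, conditional on takahashi2001_thm_2_3_of_coprime
#check @padicValNat_congruenceNumber_eq_xi_add_of_irreducible        -- prime type, Eisenstein-free form, same condition
#check @padicValNat_congruenceNumber_eq_of_not_sq_dvd                -- ARS 2012 Thm 2.1(b) (= Thm 2.2 of the published text), the A★ input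

end Summit.ABC.ABC.Cruxes.SteinbergCore.StubIdeasK1G21

end
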